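import Literature.Barriers.ValiantsHypothesis.BIJL18PermanentZero
import HarnessLib

/-!
# Bläser–Ikenmeyer–Jindal–Lysikov 2018, §6 — discharge of Lemma 25 (Fournier–Perifel–de Verclos
coefficient bound, constant-free case)

Sibling proof file of `BIJL18PermanentZero.lean` (val-lit t23). Proves the named fact
`BIJL2018_lemma25 σ`: a fan-in-exactly-two arithmetic circuit over `ℤ` with sign constants
(constants and sum coefficients in `{0, 1, -1}`), of size `s` and formal degree `d`, computes a
polynomial whose coefficients have absolute values summing to at most `2^{s·d}` — the case
`M = 2` of [BlaserIkenmeyerJindalLysikov2018, Lemma 25] = [Fournier–Perifel–de Verclos 2013]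
used in the proof of Thm. 5 ("the magnitude of coefficients of `C_k` is bounded by
`B := 2^{d(k)·s(k)}`").

Proof (the printed induction, ECCC p.18, in the tree's list-based circuit semantics): with
`H(p) = Σ_m |coeff_m p|` one has `H(p+q) ≤ H p + H q`, `H(c·p) = |c| H p`, `H(pq) ≤ H p · H q`;
along the gate list, gate number `j` (0-based) has `H ≤ 2^{(j+1)·fdeg_j}` and `fdeg_j ≥ 1`
(fan-in exactly two keeps every formal degree `≥ 1`), whence the output bound `2^{s·d}`.
HONEST FRAMING: typed literature; `VP ≠ VNP` is NOT proved and nothing here is progress on it.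
-/

noncomputable section

namespace Literature.Barriers.ValiantsHypothesis

open Literature.Computability.AlgebraicComplexity MvPolynomial ArithCircuit

universe v

variable {σ : Type v}

/-! ### The height `H(p) = Σ |coeff|` of an integer polynomial -/

/-- `H(p)` as a sum over any finite set of exponents containing the support.
[cite: BlaserIkenmeyerJindalLysikov2018, Lemma 25] -/
theorem coeffAbsSum_eq_sum_of_subset (p : MvPolynomial σ ℤ) {S : Finset (σ →₀ ℕ)}
    (hS : p.support ⊆ S) : coeffAbsSum p = ∑ m ∈ S, |coeff m p| := by
  unfold coeffAbsSum
  refine Finset.sum_subset hS fun m _ hm => ?_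
  rw [MvPolynomial.notMem_support_iff.1 hm, abs_zero]

/-- `H(p) ≥ 0`. [cite: BlaserIkenmeyerJindalLysikov2018, Lemma 25] -/
theorem coeffAbsSum_nonneg (p : MvPolynomial σ ℤ) : 0 ≤ coeffAbsSum p :=
  Finset.sum_nonneg fun _ _ => abs_nonneg _

/-- `H(0) = 0`. [cite: BlaserIkenmeyerJindalLysikov2018, Lemma 25] -/
theorem coeffAbsSum_zero : coeffAbsSum (0 : MvPolynomial σ ℤ) = 0 := by
  simp [coeffAbsSum]

/-- `H(C c) = |c|`. [cite: BlaserIkenmeyerJindalLysikov2018, Lemma 25] -/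
theorem coeffAbsSum_C (c : ℤ) : coeffAbsSum (C c : MvPolynomial σ ℤ) = |c| := by
  classical
  rw [coeffAbsSum_eq_sum_of_subset (C c) (S := {0}) (by
    rw [MvPolynomial.support_C]; split_ifs <;> simp)]
  rw [Finset.sum_singleton, MvPolynomial.coeff_zero_C]

/-- `H(X i) = 1`. [cite: BlaserIkenmeyerJindalLysikov2018, Lemma 25] -/
theorem coeffAbsSum_X (i : σ) : coeffAbsSum (X i : MvPolynomial σ ℤ) = 1 := by
  classical
  rw [coeffAbsSum_eq_sum_of_subset (X i) (S := {Finsupp.single i 1}) (MvPolynomial.support_X (R := ℤ)).subset]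
  simp [MvPolynomial.coeff_X]

/-- `H(p + q) ≤ H p + H q`. [cite: BlaserIkenmeyerJindalLysikov2018, Lemma 25] -/
theorem coeffAbsSum_add_le (p q : MvPolynomial σ ℤ) :
    coeffAbsSum (p + q) ≤ coeffAbsSum p + coeffAbsSum q := by
  classical
  rw [coeffAbsSum_eq_sum_of_subset (p + q) (S := p.support ∪ q.support) MvPolynomial.support_add,
    coeffAbsSum_eq_sum_of_subset p (S := p.support ∪ q.support) Finset.subset_union_left,
    coeffAbsSum_eq_sum_of_subset q (S := p.support ∪ q.support) Finset.subset_union_right,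
    ← Finset.sum_add_distrib]
  exact Finset.sum_le_sum fun m _ => by rw [coeff_add]; exact abs_add_le _ _

/-- `H(c • p) = |c| · H p`. [cite: BlaserIkenmeyerJindalLysikov2018, Lemma 25] -/
theorem coeffAbsSum_smul (c : ℤ) (p : MvPolynomial σ ℤ) :
    coeffAbsSum (c • p) = |c| * coeffAbsSum p := by
  classical
  rw [coeffAbsSum_eq_sum_of_subset (c • p) (S := p.support) MvPolynomial.support_smul, coeffAbsSum,
    Finset.mul_sum]
  refine Finset.sum_congr rfl fun m _ => ?_
  rw [coeff_smul, smul_eq_mul, abs_mul]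

/-- `H(p · q) ≤ H p · H q`. [cite: BlaserIkenmeyerJindalLysikov2018, Lemma 25] -/
theorem coeffAbsSum_mul_le (p q : MvPolynomial σ ℤ) :
    coeffAbsSum (p * q) ≤ coeffAbsSum p * coeffAbsSum q := by
  classical
  set P := p.support ×ˢ q.support with hP
  let f : (σ →₀ ℕ) × (σ →₀ ℕ) → ℤ := fun x => |coeff x.1 p| * |coeff x.2 q|
  have hf0 : ∀ x, x ∉ P → f x = 0 := by
    intro x hx
    simp only [hP, Finset.mem_product, not_and_or, MvPolynomial.notMem_support_iff] at hx
    rcases hx with h | h <;> simp [f, h]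
  have hfnn : ∀ x, 0 ≤ f x := fun x => mul_nonneg (abs_nonneg _) (abs_nonneg _)
  -- each coefficient of `p q` is bounded by the fibre sum of `f` over `P`
  have h1 : ∀ m, |coeff m (p * q)| ≤ ∑ x ∈ P with x.1 + x.2 = m, f x := by
    intro m
    rw [coeff_mul]
    refine (Finset.abs_sum_le_sum_abs _ _).trans ?_
    have e1 : ∑ x ∈ Finset.antidiagonal m, |coeff x.1 p * coeff x.2 q| =
        ∑ x ∈ Finset.antidiagonal m, f x :=
      Finset.sum_congr rfl fun x _ => abs_mul _ _
    rw [e1, ← Finset.sum_filter_of_ne (p := fun x => x ∈ P) (fun x _ hx => by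
      by_contra h; exact hx (hf0 x h))]
    refine le_of_eq (Finset.sum_congr ?_ fun _ _ => rfl)
    ext x
    simp only [Finset.mem_filter, Finset.mem_antidiagonal]
    tauto
  calc coeffAbsSum (p * q) = ∑ m ∈ (p * q).support, |coeff m (p * q)| := rfl
    _ ≤ ∑ m ∈ (p * q).support, ∑ x ∈ P with x.1 + x.2 = m, f x := Finset.sum_le_sum fun m _ => h1 m
    _ = ∑ x ∈ P with x.1 + x.2 ∈ (p * q).support, f x :=
        Finset.sum_fiberwise_eq_sum_filter P (p * q).support (fun x => x.1 + x.2) f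
    _ ≤ ∑ x ∈ P, f x :=
        Finset.sum_le_sum_of_subset_of_nonneg (Finset.filter_subset _ _) fun x _ _ => hfnn x
    _ = coeffAbsSum p * coeffAbsSum q := by
        rw [hP, Finset.sum_product, coeffAbsSum, coeffAbsSum, Finset.sum_mul_sum]

/-! ### The induction along the circuit -/

/-- For a sign constant `c ∈ {0, 1, -1}`, `|c| ≤ 1`. [cite: BlaserIkenmeyerJindalLysikov2018, Lemma 25] -/
theorem abs_le_one_of_isSignConstant {c : ℤ} (h : IsSignConstant c) : |c| ≤ 1 := by
  rcases h with rfl | rfl | h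
  · simp
  · simp
  · have : c = -1 := by omega
    subst this; simp

/-- Powers of two are monotone in the exponent (in `ℤ`). [cite: BlaserIkenmeyerJindalLysikov2018, Lemma 25] -/
theorem two_pow_le_two_pow {a b : ℕ} (h : a ≤ b) : (2 : ℤ) ^ a ≤ 2 ^ b :=
  pow_le_pow_right₀ (by norm_num) h

/-- **Operand step.** If every earlier gate value `vals[j]` has height `≤ 2^{(j+1)·degs[j]}` and
formal degree `degs[j] ≥ 1`, then an operand with sign constants has height
`≤ 2^{n · fdeg}` (`n` = number of earlier gates) and formal degree `≥ 1`.
[cite: BlaserIkenmeyerJindalLysikov2018, Lemma 25] -/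
theorem Operand.coeffAbsSum_eval_le (vals : List (MvPolynomial σ ℤ)) (degs : List ℕ)
    (hlen : vals.length = degs.length)
    (h : ∀ j (hj : j < vals.length),
      coeffAbsSum vals[j] ≤ 2 ^ ((j + 1) * degs[j]'(hlen ▸ hj)) ∧ 1 ≤ degs[j]'(hlen ▸ hj))
    (u : Operand ℤ σ) (hu : u.HasSignConstants) :
    coeffAbsSum (u.eval vals) ≤ 2 ^ (vals.length * u.formalDegree degs) ∧
      1 ≤ u.formalDegree degs := by
  cases u with
  | var i =>
    simp only [Operand.eval, Operand.formalDegree, coeffAbsSum_X, mul_one]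
    exact ⟨one_le_pow₀ (by norm_num), le_rfl⟩
  | const c =>
    simp only [Operand.eval, Operand.formalDegree, coeffAbsSum_C, mul_one]
    exact ⟨(abs_le_one_of_isSignConstant hu).trans (one_le_pow₀ (by norm_num)), le_rfl⟩
  | gate j =>
    simp only [Operand.eval, Operand.formalDegree, List.getD_eq_getElem?_getD]
    by_cases hj : j < vals.length
    · rw [List.getElem?_eq_getElem hj, List.getElem?_eq_getElem (hlen ▸ hj)]
      simp only [Option.getD_some]
      refine ⟨(h j hj).1.trans (two_pow_le_two_pow (Nat.mul_le_mul_right _ hj)), (h j hj).2⟩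
    · rw [List.getElem?_eq_none (by omega), List.getElem?_eq_none (by omega)]
      simp only [Option.getD_none, coeffAbsSum_zero, mul_one]
      exact ⟨pow_nonneg (by norm_num) _, le_rfl⟩

/-- **Gate step** (fan-in exactly two, sign constants): `H ≤ 2^{(n+1)·fdeg}` and `fdeg ≥ 1`:
for a sum gate `H(c₁u₁ + c₂u₂) ≤ H u₁ + H u₂ ≤ 2·2^{n·max} ≤ 2^{(n+1)·max}`; for a product gate
`H(u₁u₂) ≤ H u₁ · H u₂ ≤ 2^{n(d₁+d₂)}`. [cite: BlaserIkenmeyerJindalLysikov2018, Lemma 25] -/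
theorem Gate.coeffAbsSum_eval_le (vals : List (MvPolynomial σ ℤ)) (degs : List ℕ)
    (hlen : vals.length = degs.length)
    (h : ∀ j (hj : j < vals.length),
      coeffAbsSum vals[j] ≤ 2 ^ ((j + 1) * degs[j]'(hlen ▸ hj)) ∧ 1 ≤ degs[j]'(hlen ▸ hj))
    (g : Gate ℤ σ) (hfan : g.fanIn = 2) (hg : g.HasSignConstants) :
    coeffAbsSum (g.eval vals) ≤ 2 ^ ((vals.length + 1) * g.formalDegree degs) ∧
      1 ≤ g.formalDegree degs := by
  cases g with
  | sum args =>
    simp only [Gate.fanIn, Gate.args, List.length_map] at hfan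
    match args, hfan, hg with
    | [a₁, a₂], _, hg =>
      simp only [Gate.HasSignConstants, List.mem_cons, List.mem_nil_iff, or_false,
        forall_eq_or_imp, forall_eq] at hg
      obtain ⟨⟨hc₁, hu₁⟩, ⟨hc₂, hu₂⟩⟩ := hg
      obtain ⟨H₁, D₁⟩ := Operand.coeffAbsSum_eval_le vals degs hlen h a₁.2 hu₁
      obtain ⟨H₂, D₂⟩ := Operand.coeffAbsSum_eval_le vals degs hlen h a₂.2 hu₂
      simp only [Gate.eval, Gate.formalDegree, List.map_cons, List.map_nil, List.sum_cons,
        List.sum_nil, add_zero, List.foldr_cons, List.foldr_nil]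
      set F := max (a₁.2.formalDegree degs) (max (a₂.2.formalDegree degs) 0) with hF
      have hF₁ : a₁.2.formalDegree degs ≤ F := le_max_left _ _
      have hF₂ : a₂.2.formalDegree degs ≤ F := (le_max_left _ _).trans (le_max_right _ _)
      have hF1 : 1 ≤ F := D₁.trans hF₁
      refine ⟨?_, hF1⟩
      calc coeffAbsSum (a₁.1 • a₁.2.eval vals + a₂.1 • a₂.2.eval vals)
          ≤ coeffAbsSum (a₁.1 • a₁.2.eval vals) + coeffAbsSum (a₂.1 • a₂.2.eval vals) :=
            coeffAbsSum_add_le _ _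
        _ ≤ coeffAbsSum (a₁.2.eval vals) + coeffAbsSum (a₂.2.eval vals) := by
            rw [coeffAbsSum_smul, coeffAbsSum_smul]
            exact add_le_add
              ((mul_le_of_le_one_left (coeffAbsSum_nonneg _) (abs_le_one_of_isSignConstant hc₁)))
              ((mul_le_of_le_one_left (coeffAbsSum_nonneg _) (abs_le_one_of_isSignConstant hc₂)))
        _ ≤ 2 ^ (vals.length * F) + 2 ^ (vals.length * F) :=
            add_le_add (H₁.trans (two_pow_le_two_pow (Nat.mul_le_mul_left _ hF₁)))
              (H₂.trans (two_pow_le_two_pow (Nat.mul_le_mul_left _ hF₂)))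
        _ = 2 ^ (vals.length * F + 1) := by rw [pow_succ]; ring
        _ ≤ 2 ^ ((vals.length + 1) * F) := two_pow_le_two_pow (by nlinarith)
  | prod args =>
    simp only [Gate.fanIn, Gate.args] at hfan
    match args, hfan, hg with
    | [u₁, u₂], _, hg =>
      simp only [Gate.HasSignConstants, List.mem_cons, List.mem_nil_iff, or_false,
        forall_eq_or_imp, forall_eq] at hg
      obtain ⟨hu₁, hu₂⟩ := hg
      obtain ⟨H₁, D₁⟩ := Operand.coeffAbsSum_eval_le vals degs hlen h u₁ hu₁
      obtain ⟨H₂, D₂⟩ := Operand.coeffAbsSum_eval_le vals degs hlen h u₂ hu₂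
      simp only [Gate.eval, Gate.formalDegree, List.map_cons, List.map_nil, List.prod_cons,
        List.prod_nil, mul_one, List.sum_cons, List.sum_nil, add_zero]
      refine ⟨?_, le_add_right D₁⟩
      calc coeffAbsSum (u₁.eval vals * u₂.eval vals)
          ≤ coeffAbsSum (u₁.eval vals) * coeffAbsSum (u₂.eval vals) := coeffAbsSum_mul_le _ _
        _ ≤ 2 ^ (vals.length * u₁.formalDegree degs) * 2 ^ (vals.length * u₂.formalDegree degs) :=
            mul_le_mul H₁ H₂ (coeffAbsSum_nonneg _) (pow_nonneg (by norm_num) _)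
        _ = 2 ^ (vals.length * (u₁.formalDegree degs + u₂.formalDegree degs)) := by
            rw [← pow_add]; ring_nf
        _ ≤ 2 ^ ((vals.length + 1) * (u₁.formalDegree degs + u₂.formalDegree degs)) :=
            two_pow_le_two_pow (Nat.mul_le_mul_right _ (Nat.le_succ _))

/-- **All gate values** satisfy `H(vals[j]) ≤ 2^{(j+1)·degs[j]}` and `degs[j] ≥ 1` (induction
along the fold defining `gateValues` / `gateFormalDegrees`).
[cite: BlaserIkenmeyerJindalLysikov2018, Lemma 25] -/
theorem coeffAbsSum_gateValues_le (gs : List (Gate ℤ σ)) (hfan : ∀ g ∈ gs, g.fanIn = 2)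
    (hsign : ∀ g ∈ gs, g.HasSignConstants) :
    ∀ j (hj : j < (gateValues gs).length),
      coeffAbsSum (gateValues gs)[j] ≤ 2 ^ ((j + 1) * (gateFormalDegrees gs)[j]'(by simpa using hj)) ∧
        1 ≤ (gateFormalDegrees gs)[j]'(by simpa using hj) := by
  induction gs using List.reverseRecOn with
  | nil => intro j hj; simp at hj
  | append_singleton gs g ih =>
    intro j hj
    have hfan' : ∀ g ∈ gs, g.fanIn = 2 := fun g hg => hfan g (List.mem_append_left _ hg)
    have hsign' : ∀ g ∈ gs, g.HasSignConstants := fun g hg => hsign g (List.mem_append_left _ hg)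
    have ih' := ih hfan' hsign'
    have hlen : (gateValues gs).length = (gateFormalDegrees gs).length := by simp
    simp only [gateValues_append_singleton, gateFormalDegrees_append_singleton]
    rw [gateValues_append_singleton, List.length_append, List.length_singleton] at hj
    by_cases hj' : j < (gateValues gs).length
    · rw [List.getElem_append_left hj', List.getElem_append_left (hlen ▸ hj')]
      exact ih' j hj'
    · have hjeq : j = (gateValues gs).length := by omega
      subst hjeq
      rw [List.getElem_append_right (le_refl _)]
      rw [List.getElem_append_right (by simp)]
      simp only [Nat.sub_self, List.getElem_cons_zero, gateValues_length, gateFormalDegrees_length]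
      have hg := Gate.coeffAbsSum_eval_le _ _ hlen ih' g (hfan g (by simp)) (hsign g (by simp))
      simpa [gateValues_length] using hg

variable (σ) in
/-- **BIJL Lemma 25 (constant-free case) holds**: discharge of `BIJL2018_lemma25`.
[cite: BlaserIkenmeyerJindalLysikov2018, Lemma 25] locator: ECCC p.18; s2 p0015.txt:L11 -/
theorem BIJL2018_lemma25_holds : BIJL2018_lemma25 σ := by
  intro P hfan hsign
  have h := coeffAbsSum_gateValues_le P.gates hfan hsign.1
  have hlen : (gateValues P.gates).length = (gateFormalDegrees P.gates).length := by simp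
  have hout := (Operand.coeffAbsSum_eval_le _ _ hlen h P.output hsign.2).1
  simpa [ArithCircuit.eval, ArithCircuit.formalDegree, ArithCircuit.size, gateValues_length] using hout

end Literature.Barriers.ValiantsHypothesis

end
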